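import Summits.HodgeConjecture.CorCM.Model.RosatiThetaProduct
import Summits.HodgeConjecture.CorCM.Model.RosatiTensorForm
import Summits.HodgeConjecture.CorCM.Model.PolarContraction
import Summits.HodgeConjecture.CorCM.Model.PolarizationDatum
import Summits.HodgeConjecture.CorCM.Model.AlgDuality
import Literature.AlgebraicGeometry.Motives.AbelianVarietyProductDimProofs
import HarnessLib

/-!
# COR-CM model layer, row M22 input R2 → P (seat b26, D2/D3): the polar pair `(b, y)` of the corner product with its
# algebraicity and Rosati tensor identity — and the discharge of `var_algDuality`'s R2 hypotheses

Cell `pub-hodgecm2` (COR-CM = Hodge ladder stage 2), binder row M22 `Fact_algDuality`.  The K-a assembly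
`Model.var_algDuality` (b29, `CorCM/Model/AlgDuality.lean`) takes as its only non-structural inputs a pair of bases
`b, y` of `H¹(P(ℂ); ℚ)` of the corner product `P = A₀ × A₁ × A₂ × A₃` with
(halg) `Σ_c pr₁^* m₄(b ∘ c) ∪ pr₂^* m₄(y ∘ c) ∈ A⁴(P × P)_ℚ` and
(hRos) the ROSATI TENSOR IDENTITY `Σ_a f(b_a) ⊗ y_a = Σ_a b_a ⊗ g(y_a)` for all `ℚ`-linear `f, g` acting diagonally by
`a`, `ā` on `H¹(P(ℂ); ℚ) = ⊕ᵢ H¹(Aᵢ(ℂ); ℚ)`.  This file PRODUCES such a pair — `b` any basis, `y` the POLAR FAMILY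
(b16, `PoincareClass.exists_polClass_eq_sum`: `m^*θ - pr₁^*θ - pr₂^*θ = Σ_a pr₁^* b_a ∪ pr₂^* y_a`) of the Rosati-compatible
algebraic polarisation class `θ` of R2 (`rosatiTheta_prod4` / `var_rosatiTheta`, built on lit-milne's
`exists_rosati_ratClass_of_eigenbasis`) — and closes `var_algDuality` unconditionally (`var_algDuality_holds`).

* `polarFamily_sum_mul_eq_altDual` — the polar family REPRESENTS the alternating dual pairing of `θ`:
  `Σ_a φ(b_a) ψ(y_a) = B_θ(φ, ψ)` (`B_θ(φ, ψ) = alternatingMapToDual ℚ _ 2 ![φ, ψ] ((wedgeToCup)⁻¹ θ)`), via b16's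
  `polarFamily_eq_contraction` (`y_a = D_{b*_a} θ`) checked on cups of degree-one classes;
* `rosatiPolarPair_prod4` — for four abelian varieties with factorwise CM data (hypotheses of `rosatiTheta_prod4`):
  `∃ N (b y : Basis (Fin N) ℚ H¹(B(ℂ); ℚ)), halg ∧ hRos` — `y` a basis because `θ^{dim B} ≠ 0`
  (`polarFamily_linearIndependent`, b16; `ofRatClass_cupPow`, b15), halg = b16's
  `sum_pull_cupPowOne_cup_mem_ratAlgebraicClasses`, hRos = dual-form Rosati (`rosatiTheta_prod4`) + the tensor bridge
  `sum_tmul_rosati_of_altDual` (`RosatiTensorForm`);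
* `var_rosatiPolarPair` — the same on the Picard–CM model's corner product, in the EXACT binder spelling of
  `Model.var_algDuality` (`cmConjRingHom`, `Var.comp`/`Var.fst`/`Var.snd`, `Var.Coh`);
* `var_algDuality_holds` — **row M22 at `Var` level with no R2 hypothesis left**: the conclusion of `var_algDuality`
  for every `c : Fin 4 → CMCode`, `e i : K ≃+* (c i).E`.

HONEST FRAMING: no case of the Hodge conjecture is proved here; the algebraicity inputs are Lefschetz (1,1) (inside
lit-milne's theorem) and pull-back/cup/Gysin preservation of algebraic classes (inside b16/b17's files).

## References
* [Shimura1998] G. Shimura, *Abelian Varieties with Complex Multiplication and Modular Functions* (1998), §6.2 Thm. 4.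
* [MumfordAV1970] D. Mumford, *Abelian Varieties* (1970), §1 (4), §16.
* [Lieberman1968] D. I. Lieberman, Numerical and homological equivalence of algebraic cycles on Hodge manifolds,
  Amer. J. Math. 90 (1968), Thm. 1.
* [LangeBirkenhake1992] H. Lange, Ch. Birkenhake, *Complex Abelian Varieties* (1992), §5.1, Lemma 1.1.17.
-/

noncomputable section

open CategoryTheory MonoidalCategory CartesianMonoidalCategory TensorProduct
open scoped MonObj
open Literature.AlgebraicTopology.SingularHomology
open Literature.AlgebraicTopology.CharacteristicClasses (cupPow cupPow_zero cupPow_succ)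
open Literature.AlgebraicGeometry Literature.AlgebraicGeometry.Motives Literature.AlgebraicGeometry.HodgeTheory
open Literature.AlgebraicGeometry.ComplexMultiplication
open Literature.NumberTheory.Automorphic Literature.NumberTheory.Automorphic.PicardCM
open NumberField

namespace Summit.HodgeConjecture.CorCM.Model

/-! ### §1 The polar family represents the alternating dual pairing -/

section Represent

variable (A : AbelianVariety ℂ)

/-- **`Σ_a φ(b_a) ψ(y_a) = B_θ(φ, ψ)`** for a basis `b` of `H¹(A(ℂ); ℚ)`, the polar family `y` of `θ` along `b`
(`m^*θ - pr₁^*θ - pr₂^*θ = Σ_a pr₁^* b_a ∪ pr₂^* y_a`) and the alternating dual pairing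
`B_θ(φ, ψ) = alternatingMapToDual ℚ _ 2 ![φ, ψ] ((wedgeToCup)⁻¹ θ)`: the tensor `Σ_a b_a ⊗ y_a` REPRESENTS `B_θ`
(`y_a = D_{b*_a} θ` is the contraction, `polarFamily_eq_contraction`; both sides are linear in `θ` and agree on
`θ = v₀ ∪ v₁`, where they equal `φ(v₀)ψ(v₁) - φ(v₁)ψ(v₀)`). [cite: MumfordAV1970, §16] [cite: LangeBirkenhake1992, Lemma 1.1.17] -/
theorem polarFamily_sum_mul_eq_altDual {n : ℕ} (b : Module.Basis (Fin n) ℚ (bettiCohomology A.X 1))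
    {θ : bettiCohomology A.X 2} {y : Fin n → bettiCohomology A.X 1}
    (hℓ : BettiUniverse.pull μ[A.X] 2 θ - BettiUniverse.pull (fst A.X A.X) 2 θ - BettiUniverse.pull (snd A.X A.X) 2 θ =
      ∑ a, BettiUniverse.cup (A.X ⊗ A.X) 1 1 (BettiUniverse.pull (fst A.X A.X) 1 (b a))
        (BettiUniverse.pull (snd A.X A.X) 1 (y a)))
    (φ ψ : Module.Dual ℚ (bettiCohomology A.X 1)) :
    ∑ a, φ (b a) * ψ (y a) =
      exteriorPower.alternatingMapToDual ℚ (bettiCohomology A.X 1) 2 ![φ, ψ]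
        (((hasExteriorCohomologyH1_rat A).equiv 2).symm θ) := by
  have h := hasExteriorCohomologyH1_rat A
  have hex := fun c : Fin n ↦ exists_contraction h (b.coord c)
  choose D hD using hex
  have hy : ∀ a, y a = D a 1 θ := fun a ↦ polarFamily_eq_contraction A b hℓ D hD a
  simp only [hy]
  -- both sides are linear in `θ`
  have hsum : ∀ v : bettiCohomology A.X 1, ∑ a, φ (b a) * b.repr v a = φ v := by
    intro v
    conv_rhs => rw [← b.sum_repr v, map_sum]
    refine Finset.sum_congr rfl fun a _ ↦ ?_
    rw [map_smul, smul_eq_mul, mul_comm]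
  suffices hlin : (∑ a, φ (b a) • (ψ ∘ₗ D a 1)) =
      (exteriorPower.alternatingMapToDual ℚ (bettiCohomology A.X 1) 2 ![φ, ψ]) ∘ₗ ((h.equiv 2).symm : _ →ₗ[ℚ] _) by
    have hθ := LinearMap.congr_fun hlin θ
    simpa only [LinearMap.coe_sum, Finset.sum_apply, LinearMap.smul_apply, LinearMap.comp_apply, smul_eq_mul,
      LinearEquiv.coe_coe] using hθ
  refine LinearMap.ext_on (span_range_cupPowOne_rat_eq_top A 2) ?_
  rintro _ ⟨v, rfl⟩
  have hsymm : (h.equiv 2).symm (cupPowOne ℚ (ComplexPoints A.X) 2 v) = exteriorPower.ιMulti ℚ 2 v := by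
    rw [LinearEquiv.symm_apply_eq, HasExteriorCohomologyH1.equiv_apply, wedgeToCup_ιMulti]
  have hrem0 : (Fin.removeNth (0 : Fin 2) v) 0 = v 1 := rfl
  have hrem1 : (Fin.removeNth (1 : Fin 2) v) 0 = v 0 := rfl
  have hD1 : ∀ a, D a 1 (cupPowOne ℚ (ComplexPoints A.X) 2 v) = b.repr (v 0) a • v 1 - b.repr (v 1) a • v 0 := by
    intro a
    have h' := hD a 1 v
    rw [Fin.sum_univ_two] at h'
    simp only [Fin.val_zero, Fin.val_one, pow_zero, pow_one, one_smul, neg_smul, cupPowOne_one,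
      Module.Basis.coord_apply] at h'
    rw [hrem0, hrem1, ← sub_eq_add_neg] at h'
    exact h'
  simp only [LinearMap.coe_sum, Finset.sum_apply, LinearMap.smul_apply, LinearMap.comp_apply, smul_eq_mul,
    LinearEquiv.coe_coe, hsymm, altDual_two_ιMulti, hD1, map_sub, map_smul, mul_sub, Finset.sum_sub_distrib]
  simp only [← mul_assoc, ← Finset.sum_mul, hsum]
  ring

end Represent

/-! ### §2 The polar pair of a four-fold product with factorwise CM data -/

section Generic

variable {K : Type} [Field K] [NumberField K] [IsCMField K]

/-- **The polar pair `(b, y)` of `B = ((A₀ × A₁) × A₂) × A₃`.**  Under the hypotheses of `rosatiTheta_prod4` (factorwise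
endomorphisms diagonal on eigenbases of `H¹(Aᵢ(ℂ); ℂ)`, inducing `ℚ`-algebra actions `ι'ᵢ` on `H¹(Aᵢ(ℂ); ℚ)`) and
`0 < dim B`, there are bases `b, y` of `H¹(B(ℂ); ℚ)` (`y` = polar family of the R2 class `θ` along `b`; a basis since
`θ^{dim B} ≠ 0`) with (halg) `Σ_c pr₁^* m₄(b ∘ c) ∪ pr₂^* m₄(y ∘ c) ∈ A⁴(B × B)_ℚ` and (hRos) the tensor identity
`Σ_a f(b_a) ⊗ y_a = Σ_a b_a ⊗ g(y_a)` for all `ℚ`-linear `f, g` acting diagonally by `a`, resp. `ā`.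
[cite: Shimura1998, §6.2 Theorem 4 (3)] [cite: MumfordAV1970, §16] [cite: Lieberman1968, Thm. 1] -/
theorem rosatiPolarPair_prod4 {ι₀ ι₁ ι₂ ι₃ : Type} [Fintype ι₀] [Fintype ι₁] [Fintype ι₂] [Fintype ι₃] [Nonempty ι₀]
    (A₀ A₁ A₂ A₃ : AbelianVariety ℂ) (hB : 0 < (((A₀.prod A₁).prod A₂).prod A₃).dim)
    (u₀ : 𝓞 K → (A₀ ⟶ A₀)) (u₁ : 𝓞 K → (A₁ ⟶ A₁)) (u₂ : 𝓞 K → (A₂ ⟶ A₂)) (u₃ : 𝓞 K → (A₃ ⟶ A₃))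
    (b₀ : Module.Basis ι₀ ℂ (complexBetti A₀.X 1)) (b₁ : Module.Basis ι₁ ℂ (complexBetti A₁.X 1))
    (b₂ : Module.Basis ι₂ ℂ (complexBetti A₂.X 1)) (b₃ : Module.Basis ι₃ ℂ (complexBetti A₃.X 1))
    (τ₀ : ι₀ → (K →+* ℂ)) (τ₁ : ι₁ → (K →+* ℂ)) (τ₂ : ι₂ → (K →+* ℂ)) (τ₃ : ι₃ → (K →+* ℂ))
    (hb₀ : ∀ (a : 𝓞 K) i, complexBetti.map (u₀ a).hom.hom.hom 1 (b₀ i) = (τ₀ i (a : K)) • b₀ i)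
    (hb₁ : ∀ (a : 𝓞 K) i, complexBetti.map (u₁ a).hom.hom.hom 1 (b₁ i) = (τ₁ i (a : K)) • b₁ i)
    (hb₂ : ∀ (a : 𝓞 K) i, complexBetti.map (u₂ a).hom.hom.hom 1 (b₂ i) = (τ₂ i (a : K)) • b₂ i)
    (hb₃ : ∀ (a : 𝓞 K) i, complexBetti.map (u₃ a).hom.hom.hom 1 (b₃ i) = (τ₃ i (a : K)) • b₃ i)
    (ι'₀ : K →ₐ[ℚ] Module.End ℚ (bettiCohomology A₀.X 1)) (ι'₁ : K →ₐ[ℚ] Module.End ℚ (bettiCohomology A₁.X 1))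
    (ι'₂ : K →ₐ[ℚ] Module.End ℚ (bettiCohomology A₂.X 1)) (ι'₃ : K →ₐ[ℚ] Module.End ℚ (bettiCohomology A₃.X 1))
    (hu₀ : ∀ b : 𝓞 K, BettiUniverse.pull (u₀ b).hom.hom.hom 1 = ι'₀ (b : K))
    (hu₁ : ∀ b : 𝓞 K, BettiUniverse.pull (u₁ b).hom.hom.hom 1 = ι'₁ (b : K))
    (hu₂ : ∀ b : 𝓞 K, BettiUniverse.pull (u₂ b).hom.hom.hom 1 = ι'₂ (b : K))
    (hu₃ : ∀ b : 𝓞 K, BettiUniverse.pull (u₃ b).hom.hom.hom 1 = ι'₃ (b : K)) :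
    ∃ (N : ℕ) (b y : Module.Basis (Fin N) ℚ (bettiCohomology (((A₀.X ⊗ A₁.X) ⊗ A₂.X) ⊗ A₃.X) 1)),
      (∑ cc : Fin 4 → Fin N, bettiCup (two_mul 4).symm
        (BettiUniverse.pull (fst (((A₀.X ⊗ A₁.X) ⊗ A₂.X) ⊗ A₃.X) (((A₀.X ⊗ A₁.X) ⊗ A₂.X) ⊗ A₃.X)) 4
          (cupPowOne ℚ (ComplexPoints (((A₀.X ⊗ A₁.X) ⊗ A₂.X) ⊗ A₃.X)) 4 (fun p ↦ b (cc p))))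
        (BettiUniverse.pull (snd (((A₀.X ⊗ A₁.X) ⊗ A₂.X) ⊗ A₃.X) (((A₀.X ⊗ A₁.X) ⊗ A₂.X) ⊗ A₃.X)) 4
          (cupPowOne ℚ (ComplexPoints (((A₀.X ⊗ A₁.X) ⊗ A₂.X) ⊗ A₃.X)) 4 (fun p ↦ y (cc p))))) ∈
        ratAlgebraicClasses ((((A₀.X ⊗ A₁.X) ⊗ A₂.X) ⊗ A₃.X) ⊗ (((A₀.X ⊗ A₁.X) ⊗ A₂.X) ⊗ A₃.X)) 4 ∧
      ∀ (a : K) (f g : bettiCohomology (((A₀.X ⊗ A₁.X) ⊗ A₂.X) ⊗ A₃.X) 1 →ₗ[ℚ]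
          bettiCohomology (((A₀.X ⊗ A₁.X) ⊗ A₂.X) ⊗ A₃.X) 1),
        f ∘ₗ BettiUniverse.pull (fst ((A₀.X ⊗ A₁.X) ⊗ A₂.X) A₃.X ≫ (fst (A₀.X ⊗ A₁.X) A₂.X ≫ fst A₀.X A₁.X)) 1 =
          BettiUniverse.pull (fst ((A₀.X ⊗ A₁.X) ⊗ A₂.X) A₃.X ≫ (fst (A₀.X ⊗ A₁.X) A₂.X ≫ fst A₀.X A₁.X)) 1 ∘ₗ
            ι'₀ a →
        f ∘ₗ BettiUniverse.pull (fst ((A₀.X ⊗ A₁.X) ⊗ A₂.X) A₃.X ≫ (fst (A₀.X ⊗ A₁.X) A₂.X ≫ snd A₀.X A₁.X)) 1 =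
          BettiUniverse.pull (fst ((A₀.X ⊗ A₁.X) ⊗ A₂.X) A₃.X ≫ (fst (A₀.X ⊗ A₁.X) A₂.X ≫ snd A₀.X A₁.X)) 1 ∘ₗ
            ι'₁ a →
        f ∘ₗ BettiUniverse.pull (fst ((A₀.X ⊗ A₁.X) ⊗ A₂.X) A₃.X ≫ snd (A₀.X ⊗ A₁.X) A₂.X) 1 =
          BettiUniverse.pull (fst ((A₀.X ⊗ A₁.X) ⊗ A₂.X) A₃.X ≫ snd (A₀.X ⊗ A₁.X) A₂.X) 1 ∘ₗ ι'₂ a →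
        f ∘ₗ BettiUniverse.pull (snd ((A₀.X ⊗ A₁.X) ⊗ A₂.X) A₃.X) 1 =
          BettiUniverse.pull (snd ((A₀.X ⊗ A₁.X) ⊗ A₂.X) A₃.X) 1 ∘ₗ ι'₃ a →
        g ∘ₗ BettiUniverse.pull (fst ((A₀.X ⊗ A₁.X) ⊗ A₂.X) A₃.X ≫ (fst (A₀.X ⊗ A₁.X) A₂.X ≫ fst A₀.X A₁.X)) 1 =
          BettiUniverse.pull (fst ((A₀.X ⊗ A₁.X) ⊗ A₂.X) A₃.X ≫ (fst (A₀.X ⊗ A₁.X) A₂.X ≫ fst A₀.X A₁.X)) 1 ∘ₗ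
            ι'₀ (IsCMField.complexConj K a) →
        g ∘ₗ BettiUniverse.pull (fst ((A₀.X ⊗ A₁.X) ⊗ A₂.X) A₃.X ≫ (fst (A₀.X ⊗ A₁.X) A₂.X ≫ snd A₀.X A₁.X)) 1 =
          BettiUniverse.pull (fst ((A₀.X ⊗ A₁.X) ⊗ A₂.X) A₃.X ≫ (fst (A₀.X ⊗ A₁.X) A₂.X ≫ snd A₀.X A₁.X)) 1 ∘ₗ
            ι'₁ (IsCMField.complexConj K a) →
        g ∘ₗ BettiUniverse.pull (fst ((A₀.X ⊗ A₁.X) ⊗ A₂.X) A₃.X ≫ snd (A₀.X ⊗ A₁.X) A₂.X) 1 =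
          BettiUniverse.pull (fst ((A₀.X ⊗ A₁.X) ⊗ A₂.X) A₃.X ≫ snd (A₀.X ⊗ A₁.X) A₂.X) 1 ∘ₗ
            ι'₂ (IsCMField.complexConj K a) →
        g ∘ₗ BettiUniverse.pull (snd ((A₀.X ⊗ A₁.X) ⊗ A₂.X) A₃.X) 1 =
          BettiUniverse.pull (snd ((A₀.X ⊗ A₁.X) ⊗ A₂.X) A₃.X) 1 ∘ₗ ι'₃ (IsCMField.complexConj K a) →
        ∑ a', f (b a') ⊗ₜ[ℚ] y a' = ∑ a', b a' ⊗ₜ[ℚ] g (y a') := by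
  classical
  obtain ⟨θ, hθalg, -, htop, hros⟩ := rosatiTheta_prod4 A₀ A₁ A₂ A₃ u₀ u₁ u₂ u₃ b₀ b₁ b₂ b₃ τ₀ τ₁ τ₂ τ₃ hb₀ hb₁ hb₂ hb₃
    ι'₀ ι'₁ ι'₂ ι'₃ hu₀ hu₁ hu₂ hu₃
  haveI : FiniteDimensional ℚ (bettiCohomology (((A₀.X ⊗ A₁.X) ⊗ A₂.X) ⊗ A₃.X) 1) :=
    finiteDimensional_bettiCohomology (AbelianVariety.isSmoothProjective_holds (A := ((A₀.prod A₁).prod A₂).prod A₃)) 1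
  let b := Module.finBasis ℚ (bettiCohomology (((A₀.X ⊗ A₁.X) ⊗ A₂.X) ⊗ A₃.X) 1)
  obtain ⟨y, hℓ⟩ := exists_polClass_eq_sum (((A₀.prod A₁).prod A₂).prod A₃) b θ
  -- `θ^{dim B} ≠ 0` over `ℚ`, so the polar family is a basis
  have hk : (((A₀.prod A₁).prod A₂).prod A₃).dim - 1 + 1 = (((A₀.prod A₁).prod A₂).prod A₃).dim :=
    Nat.sub_add_cancel hB
  have hθpow : cupPow ℚ θ ((((A₀.prod A₁).prod A₂).prod A₃).dim - 1 + 1) ≠ 0 := by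
    rw [hk]
    intro h0
    apply htop
    rw [← ofRatClass_cupPow, h0, map_zero]
  have hli := polarFamily_linearIndependent (((A₀.prod A₁).prod A₂).prod A₃) hk b hθpow hℓ
  have hsp := polarFamily_span_eq_top (((A₀.prod A₁).prod A₂).prod A₃) hk b hθpow hℓ
  refine ⟨_, b, Module.Basis.mk hli hsp.ge, ?_, fun a f g h0 h1 h2 h3 h4 h5 h6 h7 ↦ ?_⟩
  · rw [Module.Basis.coe_mk]
    exact sum_pull_cupPowOne_cup_mem_ratAlgebraicClasses (((A₀.prod A₁).prod A₂).prod A₃) hθalg b y hℓ 4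
  · rw [Module.Basis.coe_mk]
    have hω : wedgeToCup ℚ _ 2 (((hasExteriorCohomologyH1_rat (((A₀.prod A₁).prod A₂).prod A₃)).equiv 2).symm θ) = θ :=
      ((hasExteriorCohomologyH1_rat (((A₀.prod A₁).prod A₂).prod A₃)).equiv 2).apply_symm_apply θ
    exact sum_tmul_rosati_of_altDual _ b y
      (polarFamily_sum_mul_eq_altDual (((A₀.prod A₁).prod A₂).prod A₃) b hℓ) f g
      (hros _ hω a f g h0 h1 h2 h3 h4 h5 h6 h7)

end Generic

/-! ### §3 The polar pair of the corner product of the Picard–CM model; discharge of `var_algDuality` -/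

section Model


/-- **The polar pair of the corner product (R2 → P, the two R2 inputs of `Model.var_algDuality` VERBATIM).**  For codes
`c : Fin 4 → CMCode` read through an abstract CM field `e i : K ≃+* (c i).E`, with `P` the left-nested product of the
`Var.cm (c i)`: bases `b, y : Basis (Fin N) ℚ (H¹(P(ℂ); ℚ))` with (halg) `Σ_c pr₁^* m₄(b ∘ c) ∪ pr₂^* m₄(y ∘ c) ∈
A⁴(P × P)_ℚ` and (hRos) `Σ_a f(b_a) ⊗ y_a = Σ_a b_a ⊗ g(y_a)` for all `ℚ`-linear `f, g` acting diagonally by `a`, `ā`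
(the `k = 1` clauses of `IsDiagAct`, `cmConjRingHom K a`). [cite: Shimura1998, §6.2 Theorem 4 (3)] [cite: MumfordAV1970, §16] -/
theorem var_rosatiPolarPair (hHD : exists_isReal_hodgeModel) (hI : hodgePQ_independent_of_hodgeModel)
    (hU : BallQuotientUniformisedDatum) (h₃ : CMAbelianVarietyRealised)
    (c : Fin 4 → CMCode) {K : Type} [Field K] [NumberField K] [NumberField.IsCMField K]
    (e : (i : Fin 4) → (K ≃+* (c i).E)) :
    ∃ (N : ℕ) (b y : Module.Basis (Fin N) ℚ
      (Var.Coh hU h₃ (Var.prod (Var.prod (Var.prod (.cm (c 0)) (.cm (c 1))) (.cm (c 2))) (.cm (c 3))) 1)),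
      (∑ cc : Fin 4 → Fin N, bettiCup (two_mul 4).symm
        (BettiUniverse.pull
            (fst (Var.scheme hU h₃ (Var.prod (Var.prod (Var.prod (.cm (c 0)) (.cm (c 1))) (.cm (c 2))) (.cm (c 3))))
              (Var.scheme hU h₃ (Var.prod (Var.prod (Var.prod (.cm (c 0)) (.cm (c 1))) (.cm (c 2))) (.cm (c 3))))) 4
          (cupPowOne ℚ (ComplexPoints
            (Var.scheme hU h₃ (Var.prod (Var.prod (Var.prod (.cm (c 0)) (.cm (c 1))) (.cm (c 2))) (.cm (c 3))))) 4
            (fun p ↦ b (cc p))))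
        (BettiUniverse.pull
            (snd (Var.scheme hU h₃ (Var.prod (Var.prod (Var.prod (.cm (c 0)) (.cm (c 1))) (.cm (c 2))) (.cm (c 3))))
              (Var.scheme hU h₃ (Var.prod (Var.prod (Var.prod (.cm (c 0)) (.cm (c 1))) (.cm (c 2))) (.cm (c 3))))) 4
          (cupPowOne ℚ (ComplexPoints
            (Var.scheme hU h₃ (Var.prod (Var.prod (Var.prod (.cm (c 0)) (.cm (c 1))) (.cm (c 2))) (.cm (c 3))))) 4
            (fun p ↦ y (cc p))))) ∈
      ratAlgebraicClasses
        (Var.scheme hU h₃ (Var.prod (Var.prod (Var.prod (.cm (c 0)) (.cm (c 1))) (.cm (c 2))) (.cm (c 3))) ⊗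
          Var.scheme hU h₃ (Var.prod (Var.prod (Var.prod (.cm (c 0)) (.cm (c 1))) (.cm (c 2))) (.cm (c 3)))) 4 ∧
      (∀ (a : K)
      (f g : Var.Coh hU h₃ (Var.prod (Var.prod (Var.prod (.cm (c 0)) (.cm (c 1))) (.cm (c 2))) (.cm (c 3))) 1 →ₗ[ℚ]
        Var.Coh hU h₃ (Var.prod (Var.prod (Var.prod (.cm (c 0)) (.cm (c 1))) (.cm (c 2))) (.cm (c 3))) 1),
      f ∘ₗ BettiUniverse.pull (Var.comp hU h₃ (Var.fst hU h₃ _ (.cm (c 3)))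
          (Var.comp hU h₃ (Var.fst hU h₃ _ (.cm (c 2))) (Var.fst hU h₃ (.cm (c 0)) (.cm (c 1))))) 1 =
        BettiUniverse.pull (Var.comp hU h₃ (Var.fst hU h₃ _ (.cm (c 3)))
          (Var.comp hU h₃ (Var.fst hU h₃ _ (.cm (c 2))) (Var.fst hU h₃ (.cm (c 0)) (.cm (c 1))))) 1 ∘ₗ
          (BettiUniverse.cmEndAction ((cmRealisation h₃ (c 0)).θ.comp (e 0).toRingHom)
            ((cmRealisation h₃ (c 0)).exists_map_comp (e 0)) hHD hI (Var.isSmoothProjective hU h₃ (.cm (c 0)))).ι a →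
      f ∘ₗ BettiUniverse.pull (Var.comp hU h₃ (Var.fst hU h₃ _ (.cm (c 3)))
          (Var.comp hU h₃ (Var.fst hU h₃ _ (.cm (c 2))) (Var.snd hU h₃ (.cm (c 0)) (.cm (c 1))))) 1 =
        BettiUniverse.pull (Var.comp hU h₃ (Var.fst hU h₃ _ (.cm (c 3)))
          (Var.comp hU h₃ (Var.fst hU h₃ _ (.cm (c 2))) (Var.snd hU h₃ (.cm (c 0)) (.cm (c 1))))) 1 ∘ₗ
          (BettiUniverse.cmEndAction ((cmRealisation h₃ (c 1)).θ.comp (e 1).toRingHom)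
            ((cmRealisation h₃ (c 1)).exists_map_comp (e 1)) hHD hI (Var.isSmoothProjective hU h₃ (.cm (c 1)))).ι a →
      f ∘ₗ BettiUniverse.pull (Var.comp hU h₃ (Var.fst hU h₃ _ (.cm (c 3))) (Var.snd hU h₃ _ (.cm (c 2)))) 1 =
        BettiUniverse.pull (Var.comp hU h₃ (Var.fst hU h₃ _ (.cm (c 3))) (Var.snd hU h₃ _ (.cm (c 2)))) 1 ∘ₗ
          (BettiUniverse.cmEndAction ((cmRealisation h₃ (c 2)).θ.comp (e 2).toRingHom)
            ((cmRealisation h₃ (c 2)).exists_map_comp (e 2)) hHD hI (Var.isSmoothProjective hU h₃ (.cm (c 2)))).ι a →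
      f ∘ₗ BettiUniverse.pull (Var.snd hU h₃ _ (.cm (c 3))) 1 =
        BettiUniverse.pull (Var.snd hU h₃ _ (.cm (c 3))) 1 ∘ₗ
          (BettiUniverse.cmEndAction ((cmRealisation h₃ (c 3)).θ.comp (e 3).toRingHom)
            ((cmRealisation h₃ (c 3)).exists_map_comp (e 3)) hHD hI (Var.isSmoothProjective hU h₃ (.cm (c 3)))).ι a →
      g ∘ₗ BettiUniverse.pull (Var.comp hU h₃ (Var.fst hU h₃ _ (.cm (c 3)))
          (Var.comp hU h₃ (Var.fst hU h₃ _ (.cm (c 2))) (Var.fst hU h₃ (.cm (c 0)) (.cm (c 1))))) 1 =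
        BettiUniverse.pull (Var.comp hU h₃ (Var.fst hU h₃ _ (.cm (c 3)))
          (Var.comp hU h₃ (Var.fst hU h₃ _ (.cm (c 2))) (Var.fst hU h₃ (.cm (c 0)) (.cm (c 1))))) 1 ∘ₗ
          (BettiUniverse.cmEndAction ((cmRealisation h₃ (c 0)).θ.comp (e 0).toRingHom)
            ((cmRealisation h₃ (c 0)).exists_map_comp (e 0)) hHD hI (Var.isSmoothProjective hU h₃ (.cm (c 0)))).ι
            (cmConjRingHom K a) →
      g ∘ₗ BettiUniverse.pull (Var.comp hU h₃ (Var.fst hU h₃ _ (.cm (c 3)))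
          (Var.comp hU h₃ (Var.fst hU h₃ _ (.cm (c 2))) (Var.snd hU h₃ (.cm (c 0)) (.cm (c 1))))) 1 =
        BettiUniverse.pull (Var.comp hU h₃ (Var.fst hU h₃ _ (.cm (c 3)))
          (Var.comp hU h₃ (Var.fst hU h₃ _ (.cm (c 2))) (Var.snd hU h₃ (.cm (c 0)) (.cm (c 1))))) 1 ∘ₗ
          (BettiUniverse.cmEndAction ((cmRealisation h₃ (c 1)).θ.comp (e 1).toRingHom)
            ((cmRealisation h₃ (c 1)).exists_map_comp (e 1)) hHD hI (Var.isSmoothProjective hU h₃ (.cm (c 1)))).ι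
            (cmConjRingHom K a) →
      g ∘ₗ BettiUniverse.pull (Var.comp hU h₃ (Var.fst hU h₃ _ (.cm (c 3))) (Var.snd hU h₃ _ (.cm (c 2)))) 1 =
        BettiUniverse.pull (Var.comp hU h₃ (Var.fst hU h₃ _ (.cm (c 3))) (Var.snd hU h₃ _ (.cm (c 2)))) 1 ∘ₗ
          (BettiUniverse.cmEndAction ((cmRealisation h₃ (c 2)).θ.comp (e 2).toRingHom)
            ((cmRealisation h₃ (c 2)).exists_map_comp (e 2)) hHD hI (Var.isSmoothProjective hU h₃ (.cm (c 2)))).ι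
            (cmConjRingHom K a) →
      g ∘ₗ BettiUniverse.pull (Var.snd hU h₃ _ (.cm (c 3))) 1 =
        BettiUniverse.pull (Var.snd hU h₃ _ (.cm (c 3))) 1 ∘ₗ
          (BettiUniverse.cmEndAction ((cmRealisation h₃ (c 3)).θ.comp (e 3).toRingHom)
            ((cmRealisation h₃ (c 3)).exists_map_comp (e 3)) hHD hI (Var.isSmoothProjective hU h₃ (.cm (c 3)))).ι
            (cmConjRingHom K a) →
      ∑ a', f (b a') ⊗ₜ[ℚ] y a' = ∑ a', b a' ⊗ₜ[ℚ] g (y a')) := by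
  obtain ⟨v₀, hv₀⟩ := exists_eigenbasis_cmRealisation h₃ (c 0) (e 0)
  obtain ⟨v₁, hv₁⟩ := exists_eigenbasis_cmRealisation h₃ (c 1) (e 1)
  obtain ⟨v₂, hv₂⟩ := exists_eigenbasis_cmRealisation h₃ (c 2) (e 2)
  obtain ⟨v₃, hv₃⟩ := exists_eigenbasis_cmRealisation h₃ (c 3) (e 3)
  have hB : 0 < ((((cmRealisation h₃ (c 0)).AV.prod (cmRealisation h₃ (c 1)).AV).prod
      (cmRealisation h₃ (c 2)).AV).prod (cmRealisation h₃ (c 3)).AV).dim := by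
    rw [AbelianVariety.dim_prod]
    exact Nat.add_pos_right _ (cmRealisation_dim_pos h₃ (c 3))
  obtain ⟨N, b, y, halg, hRos⟩ := rosatiPolarPair_prod4 (K := K)
    (cmRealisation h₃ (c 0)).AV (cmRealisation h₃ (c 1)).AV (cmRealisation h₃ (c 2)).AV (cmRealisation h₃ (c 3)).AV hB
    (fun b ↦ (cmRealisation h₃ (c 0)).ι (RingOfIntegers.mapRingEquiv (e 0) b))
    (fun b ↦ (cmRealisation h₃ (c 1)).ι (RingOfIntegers.mapRingEquiv (e 1) b))
    (fun b ↦ (cmRealisation h₃ (c 2)).ι (RingOfIntegers.mapRingEquiv (e 2) b))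
    (fun b ↦ (cmRealisation h₃ (c 3)).ι (RingOfIntegers.mapRingEquiv (e 3) b))
    v₀ v₁ v₂ v₃ (fun σ ↦ σ.comp (e 0).toRingHom) (fun σ ↦ σ.comp (e 1).toRingHom)
    (fun σ ↦ σ.comp (e 2).toRingHom) (fun σ ↦ σ.comp (e 3).toRingHom) hv₀ hv₁ hv₂ hv₃ _ _ _ _
    (pull_cmRealisation_ι hHD hI hU h₃ (c 0) (e 0)) (pull_cmRealisation_ι hHD hI hU h₃ (c 1) (e 1))
    (pull_cmRealisation_ι hHD hI hU h₃ (c 2) (e 2)) (pull_cmRealisation_ι hHD hI hU h₃ (c 3) (e 3))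
  exact ⟨N, b, y, halg, fun a f g h0 h1 h2 h3 h4 h5 h6 h7 ↦ hRos a f g h0 h1 h2 h3 h4 h5 h6 h7⟩

/-- **Row M22 (`Fact_algDuality`) at `Var` level, R2 discharged**: for every four CM codes `c` and abstract CM field
`e i : K ≃+* (c i).E` the conclusion of `Model.var_algDuality` (b29: a `ℚ`-linear bijection
`D : H^{2 dim P - 4}(P; ℚ) → H⁴(P; ℚ)` preserving rational algebraic classes and intertwining the diagonal action of `a`
with that of `ā` up to `N(a)⁴`) holds with NO remaining hypothesis — its inputs `(b, y, halg, hRos)` are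
`var_rosatiPolarPair`. [cite: Lieberman1968, Thm. 1] [cite: Shimura1998, §6.2 Theorem 4 (3)] -/
theorem var_algDuality_holds (hHD : exists_isReal_hodgeModel) (hI : hodgePQ_independent_of_hodgeModel)
    (hU : BallQuotientUniformisedDatum) (h₃ : CMAbelianVarietyRealised)
    (c : Fin 4 → CMCode) {K : Type} [Field K] [NumberField K] [NumberField.IsCMField K]
    (e : (i : Fin 4) → (K ≃+* (c i).E)) :
    ∃ D : Var.Coh hU h₃ (Var.prod (Var.prod (Var.prod (.cm (c 0)) (.cm (c 1))) (.cm (c 2))) (.cm (c 3)))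
          (2 * (Var.dim (Var.prod (Var.prod (Var.prod (.cm (c 0)) (.cm (c 1))) (.cm (c 2))) (.cm (c 3))) - 2)) →ₗ[ℚ]
        Var.Coh hU h₃ (Var.prod (Var.prod (Var.prod (.cm (c 0)) (.cm (c 1))) (.cm (c 2))) (.cm (c 3))) 4,
      Function.Bijective D ∧
      (Var.alg hU h₃ (Var.prod (Var.prod (Var.prod (.cm (c 0)) (.cm (c 1))) (.cm (c 2))) (.cm (c 3)))
          (Var.dim (Var.prod (Var.prod (Var.prod (.cm (c 0)) (.cm (c 1))) (.cm (c 2))) (.cm (c 3))) - 2)).map D ≤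
        Var.alg hU h₃ (Var.prod (Var.prod (Var.prod (.cm (c 0)) (.cm (c 1))) (.cm (c 2))) (.cm (c 3))) 2 ∧
      ∀ (a : K)
        (Ma Mb : Var.Mor hU h₃ (Var.prod (Var.prod (Var.prod (.cm (c 0)) (.cm (c 1))) (.cm (c 2))) (.cm (c 3)))
          (Var.prod (Var.prod (Var.prod (.cm (c 0)) (.cm (c 1))) (.cm (c 2))) (.cm (c 3))))
        (da db : (i : Fin 4) → Var.Mor hU h₃ (.cm (c i)) (.cm (c i))),
        (∀ i, BettiUniverse.pull (da i) 1 =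
          (BettiUniverse.cmEndAction ((cmRealisation h₃ (c i)).θ.comp (e i).toRingHom)
            ((cmRealisation h₃ (c i)).exists_map_comp (e i)) hHD hI (Var.isSmoothProjective hU h₃ (.cm (c i)))).ι a) →
        (∀ k, BettiUniverse.pull Ma k ∘ₗ
            BettiUniverse.pull (Var.comp hU h₃ (Var.fst hU h₃ _ (.cm (c 3)))
              (Var.comp hU h₃ (Var.fst hU h₃ _ (.cm (c 2))) (Var.fst hU h₃ (.cm (c 0)) (.cm (c 1))))) k =
          BettiUniverse.pull (Var.comp hU h₃ (Var.fst hU h₃ _ (.cm (c 3)))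
              (Var.comp hU h₃ (Var.fst hU h₃ _ (.cm (c 2))) (Var.fst hU h₃ (.cm (c 0)) (.cm (c 1))))) k ∘ₗ
            BettiUniverse.pull (da 0) k) →
        (∀ k, BettiUniverse.pull Ma k ∘ₗ
            BettiUniverse.pull (Var.comp hU h₃ (Var.fst hU h₃ _ (.cm (c 3)))
              (Var.comp hU h₃ (Var.fst hU h₃ _ (.cm (c 2))) (Var.snd hU h₃ (.cm (c 0)) (.cm (c 1))))) k =
          BettiUniverse.pull (Var.comp hU h₃ (Var.fst hU h₃ _ (.cm (c 3)))
              (Var.comp hU h₃ (Var.fst hU h₃ _ (.cm (c 2))) (Var.snd hU h₃ (.cm (c 0)) (.cm (c 1))))) k ∘ₗ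
            BettiUniverse.pull (da 1) k) →
        (∀ k, BettiUniverse.pull Ma k ∘ₗ
            BettiUniverse.pull (Var.comp hU h₃ (Var.fst hU h₃ _ (.cm (c 3))) (Var.snd hU h₃ _ (.cm (c 2)))) k =
          BettiUniverse.pull (Var.comp hU h₃ (Var.fst hU h₃ _ (.cm (c 3))) (Var.snd hU h₃ _ (.cm (c 2)))) k ∘ₗ
            BettiUniverse.pull (da 2) k) →
        (∀ k, BettiUniverse.pull Ma k ∘ₗ BettiUniverse.pull (Var.snd hU h₃ _ (.cm (c 3))) k =
          BettiUniverse.pull (Var.snd hU h₃ _ (.cm (c 3))) k ∘ₗ BettiUniverse.pull (da 3) k) →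
        (∀ i, BettiUniverse.pull (db i) 1 =
          (BettiUniverse.cmEndAction ((cmRealisation h₃ (c i)).θ.comp (e i).toRingHom)
            ((cmRealisation h₃ (c i)).exists_map_comp (e i)) hHD hI (Var.isSmoothProjective hU h₃ (.cm (c i)))).ι
            (cmConjRingHom K a)) →
        (∀ k, BettiUniverse.pull Mb k ∘ₗ
            BettiUniverse.pull (Var.comp hU h₃ (Var.fst hU h₃ _ (.cm (c 3)))
              (Var.comp hU h₃ (Var.fst hU h₃ _ (.cm (c 2))) (Var.fst hU h₃ (.cm (c 0)) (.cm (c 1))))) k =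
          BettiUniverse.pull (Var.comp hU h₃ (Var.fst hU h₃ _ (.cm (c 3)))
              (Var.comp hU h₃ (Var.fst hU h₃ _ (.cm (c 2))) (Var.fst hU h₃ (.cm (c 0)) (.cm (c 1))))) k ∘ₗ
            BettiUniverse.pull (db 0) k) →
        (∀ k, BettiUniverse.pull Mb k ∘ₗ
            BettiUniverse.pull (Var.comp hU h₃ (Var.fst hU h₃ _ (.cm (c 3)))
              (Var.comp hU h₃ (Var.fst hU h₃ _ (.cm (c 2))) (Var.snd hU h₃ (.cm (c 0)) (.cm (c 1))))) k =
          BettiUniverse.pull (Var.comp hU h₃ (Var.fst hU h₃ _ (.cm (c 3)))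
              (Var.comp hU h₃ (Var.fst hU h₃ _ (.cm (c 2))) (Var.snd hU h₃ (.cm (c 0)) (.cm (c 1))))) k ∘ₗ
            BettiUniverse.pull (db 1) k) →
        (∀ k, BettiUniverse.pull Mb k ∘ₗ
            BettiUniverse.pull (Var.comp hU h₃ (Var.fst hU h₃ _ (.cm (c 3))) (Var.snd hU h₃ _ (.cm (c 2)))) k =
          BettiUniverse.pull (Var.comp hU h₃ (Var.fst hU h₃ _ (.cm (c 3))) (Var.snd hU h₃ _ (.cm (c 2)))) k ∘ₗ
            BettiUniverse.pull (db 2) k) →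
        (∀ k, BettiUniverse.pull Mb k ∘ₗ BettiUniverse.pull (Var.snd hU h₃ _ (.cm (c 3))) k =
          BettiUniverse.pull (Var.snd hU h₃ _ (.cm (c 3))) k ∘ₗ BettiUniverse.pull (db 3) k) →
        BettiUniverse.pull Mb 4 ∘ₗ D ∘ₗ BettiUniverse.pull Ma
            (2 * (Var.dim (Var.prod (Var.prod (Var.prod (.cm (c 0)) (.cm (c 1))) (.cm (c 2))) (.cm (c 3))) - 2)) =
          ((Algebra.norm ℚ a) ^ 4) • D := by
  obtain ⟨N, b, y, halg, hRos⟩ := var_rosatiPolarPair hHD hI hU h₃ c e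
  exact var_algDuality hHD hI hU h₃ c e b y halg hRos

end Model

end Summit.HodgeConjecture.CorCM.Model

end
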